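import Summits.BirchSwinnertonDyer.Rank1Residual.GaloisImage.KolyvaginTransferCocycle
import Summits.BirchSwinnertonDyer.Rank1Residual.GaloisImage.FrobeniusPowerCongruence
import HarnessLib

/-!
# The Kolyvagin congruence of an Euler system at a `p`-level where Frobenius generates the layer
# (Perrin-Riou, Prop. 2.2.5 (ii): the ascent, for the tree's `IsEulerSystem`) — file C0d of
# THEOREM C of row T-DER (cell `b2b-bsdres`, team n1011, seat p11 GEN 9, OWNERS row T-DER =
# skel/T-DER.md STATUS v8 (v8-2), referee-1 GEN 35 ACK-1 provisos (ii)–(iv))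

HONEST FRAMING (cell `b2b-bsdres`, run/shared/lean/b2b/bsd-rank1-residual/, verbatim in every
file): the goal of the cell is to DELETE the COMBINATION-SHAPED residual classes of the
Birch–Swinnerton-Dyer formula for ALL analytic-rank `≤ 1` elliptic curves over `ℚ` — "full BSD
formula for every rank `≤ 1` curve in class `C`" assembled STRICTLY from published theorems — so
that the rank-`≤ 1` remainder becomes exactly the CONSTRUCTION-SHAPED classes, which are TYPED
(missing-input `Prop`s), NOT attempted. This is not "finishing BSD". Team n1011: research route on
the CONSTRUCTION-SHAPED class X4 / §I N11 (route-1 PORT, (P-DER)); TOOL theorems of continuous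
Galois cohomology (no definition, no named fact, no `sorry`); curve-free, `p`-free.

## What ([PerrinRiou98] Prop. 2.2.5 (ii), proof pp. 1252–1253, for `IsEulerSystem L T p c`)

Fix an Euler system `c` (`IsEulerSystem L T p c`), a squarefree `r`, a usable prime `q ∉ r`, and
two layers `i₀ ≤ i₂` of the `K_∞`-direction (`F_{i₀} ⊂ F_{i₂}`; for `ℚ(μ_{p^∞})`: `i₀ = v_p(q^f−1)`,
`i₂ = i₀ + n`).  Data at a prime `𝔔 ∣ q` (all DISPLAYED, nothing hidden): an arithmetic Frobenius
`Fr` at `q`; a tame generator `σ` (powers = transversal of `Gal(F_{i₂}(rq)/F_{i₂}(r))`, acting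
trivially on `T`, lying in an "inertia" subgroup `I`); an element `φ ∈ Gal(K̄/F_{i₀}(rq))` whose powers
`φ^j`, `j < M = p^n`, are a transversal of BOTH layers `Gal(F_{i₂}(rq)/F_{i₀}(rq))` and
`Gal(F_{i₂}(r)/F_{i₀}(r))` (**`q` inert in the layer**: Perrin-Riou's "Frob_λ engendre le groupe de
Galois de F(μ_{p^{r+n}})/F(μ_{p^r})" — the layer arithmetic is NOT proved here, it is the binder
`hcovφ/hinjφ`, supplied over `ℚ` by n1011-p15's `Rat.exists_lt_frobenius_pow_inv_mul_mem_level` /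
`Rat.eq_of_frobenius_pow_inv_mul_mem_level`, file `CyclotomicLevelPTowerTransversal`), with
`φ^M − 1` injective on `T` (`hinjM`, Weil) and `(ρ(φ) − 1)²T ⊆ pT` (`hroom`, the Kolyvagin-prime
arithmetic `q ≡ 1`, `a_q ≡ 2 (mod p)`: n1011-p15 `…exists_sub_one_sub_one_eq_galoisRepTate_of_isKolyvaginPrime`);
the operator identity `P_q(Fr⁻¹) = N_q • Z` on `T` (`hZ`, n1011-p13 K4
`Rat.aeval_galoisRepTate_inv_rubinEulerFactor_eq_nsmul`) with `Z` commuting with `ρ(φ)`;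
`N_q = p^{r₁} d`, `d` invertible, `r₁ ≤ n`; no `p`-torsion; a subgroup `D ∋ Fr, φ` normalising `I`
with `[φ, Fr] ∈ I` (decomposition data at `𝔔`); and the vanishing of every `T`-valued cocycle of the
two level-`i₂` groups on `I` (`hurI'`, `hurI`: unramifiedness of `H¹(F_{i₂}(·), T)` at `q ∤ p`, item (3)
of THEOREM C, an F6/F8-type input).  THEN for ALL representatives `x₀'` of `c_{i₀,rq}` and `x₀` of
`c_{i₀,r}`:

  **`x₀'(φ) − Z x₀(φ) ∈ (φ − 1) T`**   (`exists_sub_eq_sub_one_apply_of_eulerSystem`).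

Proof = [PerrinRiou98] p. 1252–1253 in the tree's currency: (2.2.6)–(2.2.7) from
**`IsEulerSystem.cores_p`** at `rq` and at `r` (G1 `exists_forall_sum_rho_pow_apply_eq_of_coresLe_eq`
+ C0b `eq_add_rho_sub_of_sum_conj_eq`); (2.2.8) from `IsEulerSystem.cores_cons` at level `i₂` (G1
`exists_forall_sum_rho_pow_apply_eq_of_coresLe_eq_aeval`) evaluated at `φ^M` (C2
`sum_rho_pow_apply_subgroupConj_eq_nsmul`, inertia killed); the room `(Φ^M − 1)T ⊆ M(Φ−1)T` from C0a
`exists_pow_prime_pow_sub_one_apply_eq'`; the division by `q − 1` = C0b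
`exists_sub_eq_sub_one_apply_of_ascent`.  The descent to the bottom layer is C0c (file
`KolyvaginCongruenceDescent`) and the transport through `D_r` is file G3.  0 defs, 0 facts.

References: B. Perrin-Riou, Ann. Inst. Fourier 48 (1998), Prop. 2.2.5 (ii) pp. 1252–1253;
K. Rubin, in LNM 1716 (1999), Prop. 8.6; K. Rubin, *Euler Systems* (2000), §4.8, Cor. 4.8.1.
-/

noncomputable section

open CategoryTheory Function Finset Polynomial Field IsDedekindDomain
open scoped NumberField
open Literature.NumberTheory.GaloisRepresentations
open Literature.NumberTheory.EllipticCurves (subgroupInclusion subgroupInclusion_apply_coe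
  subgroupConj subgroupConj_apply_coe)

universe u v w

namespace Summit.BirchSwinnertonDyer.Rank1Residual.GaloisImage

namespace Congruence

/-! ### §1 Group-theoretic bookkeeping at a prime: commutators of powers modulo a normalised
subgroup -/

section Group

variable {G : Type u} [Group G]

/-- If `D` normalises `I` and `a, b ∈ D` commute modulo `I` (`a⁻¹ b⁻¹ a b ∈ I`), then so do all
their powers: `(a^m)⁻¹ (b^k)⁻¹ a^m b^k ∈ I`. [folklore] -/
theorem commutator_pow_pow_mem (I D : Subgroup G) (hID : ∀ g ∈ D, ∀ τ ∈ I, g⁻¹ * τ * g ∈ I)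
    {a b : G} (ha : a ∈ D) (hb : b ∈ D) (hab : a⁻¹ * b⁻¹ * a * b ∈ I) (m k : ℕ) :
    (a ^ m)⁻¹ * (b ^ k)⁻¹ * a ^ m * b ^ k ∈ I := by
  -- work in `D ⧸ (I ⊓ D)`: the images of `a`, `b` commute
  have hID' : ∀ g ∈ D, ∀ τ ∈ I, g * τ * g⁻¹ ∈ I := fun g hg τ hτ => by
    simpa using hID g⁻¹ (D.inv_mem hg) τ hτ
  -- first `a` and `b^k`
  have hk : ∀ k : ℕ, a⁻¹ * (b ^ k)⁻¹ * a * b ^ k ∈ I := by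
    intro k
    induction k with
    | zero => simp [I.one_mem]
    | succ k ih =>
      -- `a⁻¹ b^{-(k+1)} a b^{k+1} = b⁻¹ (b (a⁻¹ b^{-k} ... ) ...)`: write via conjugation
      have h1 : a⁻¹ * (b ^ (k + 1))⁻¹ * a * b ^ (k + 1) =
          (b ^ k)⁻¹ * ((b ^ k * (a⁻¹ * (b ^ k)⁻¹ * a * b ^ k) * (b ^ k)⁻¹) *
            (b⁻¹ * (b * (a⁻¹ * b⁻¹ * a * b) * b⁻¹) * b)) * b ^ k := by group
      rw [h1]
      refine hID (b ^ k) (D.pow_mem hb k) _ (I.mul_mem ?_ ?_)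
      · exact hID' (b ^ k) (D.pow_mem hb k) _ ih
      · exact hID b hb _ (hID' b hb _ hab)
  -- then `a^m` and `b^k` by induction on `m`
  induction m with
  | zero => simp [I.one_mem]
  | succ m ih =>
    have h1 : (a ^ (m + 1))⁻¹ * (b ^ k)⁻¹ * a ^ (m + 1) * b ^ k =
        (a⁻¹ * ((a ^ m)⁻¹ * (b ^ k)⁻¹ * a ^ m * b ^ k) * a) * (a⁻¹ * (b ^ k)⁻¹ * a * b ^ k) := by
      group
    rw [h1]
    exact I.mul_mem (hID a ha _ ih) (hk k)

/-- The element `φ⁻¹ σ^{-i} φ σ^i` lies in `I` when `σ ∈ I` and `φ` normalises `I`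
(`φ⁻¹ σ^{-i} φ ∈ I`). [folklore] -/
theorem inv_mul_conj_pow_mem (I D : Subgroup G) (hID : ∀ g ∈ D, ∀ τ ∈ I, g⁻¹ * τ * g ∈ I)
    {σ φ : G} (hσ : σ ∈ I) (hφ : φ ∈ D) (i : ℕ) : φ⁻¹ * ((σ ^ i)⁻¹ * φ * σ ^ i) ∈ I := by
  have h1 : φ⁻¹ * ((σ ^ i)⁻¹ * φ * σ ^ i) = (φ⁻¹ * (σ ^ i)⁻¹ * φ) * σ ^ i := by group
  rw [h1]
  exact I.mul_mem (hID φ hφ _ (I.inv_mem (I.pow_mem hσ i))) (I.pow_mem hσ i)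

end Group

/-! ### §1b The descent step on values (C0c `exists_sub_eq_sub_one_apply_of_descent`, freed from
the cocycles) -/

section Values

variable {R : Type v} [CommRing R] [TopologicalSpace R]
variable {G : Type u} [Group G]
variable (X : TopRep.{u} R G)

/-- **C0c on values.**  With `a j = x_r(γ^{-j}φγ^j)`, `a' j = x'_r(γ^{-j}φγ^j)`, `y₀ = x_0(φ)`,
`y₀' = x'_0(φ)`: if `Σ_{j<N'} γ^j a_j = y₀ + (φ−1)t`, `Σ_{j<N'} γ^j a'_j = y₀' + (φ−1)t'`, `Z` commutes
with `φ`, and `a'_j − γ^{-j}Zγ^j a_j ∈ (γ^{-j}φγ^j − 1)X` for all `j < N'`, then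
`y₀' − Z y₀ ∈ (φ − 1)X`.  (Same proof as C0c; stated on values so that the four cocycles may live on
four different groups.) [cite: PerrinRiou1998AIF, Prop. 2.2.5 (ii)] -/
theorem exists_sub_eq_sub_one_apply_of_descent_values (Z : X →ₗ[R] X) (φ γ : G) (N' : ℕ)
    (hZφ : ∀ v : X, Z (X.ρ φ v) = X.ρ φ (Z v)) (a a' : ℕ → X) (y₀ y₀' t t' : X)
    (hcor : ∑ j ∈ range N', X.ρ (γ ^ j) (a j) = y₀ + (X.ρ φ t - t))
    (hcor' : ∑ j ∈ range N', X.ρ (γ ^ j) (a' j) = y₀' + (X.ρ φ t' - t'))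
    (hcong : ∀ j ∈ range N', ∃ w : X,
      a' j - X.ρ (γ ^ j)⁻¹ (Z (X.ρ (γ ^ j) (a j))) = X.ρ ((γ ^ j)⁻¹ * φ * γ ^ j) w - w) :
    ∃ w : X, y₀' - Z y₀ = X.ρ φ w - w := by
  have hcong' : ∀ j : ℕ, ∃ w : X, j ∈ range N' →
      a' j - X.ρ (γ ^ j)⁻¹ (Z (X.ρ (γ ^ j) (a j))) = X.ρ ((γ ^ j)⁻¹ * φ * γ ^ j) w - w := fun j => by
    by_cases hj : j ∈ range N'
    · obtain ⟨w, hw⟩ := hcong j hj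
      exact ⟨w, fun _ => hw⟩
    · exact ⟨0, fun h => absurd h hj⟩
  choose w hw using hcong'
  have hj : ∀ j ∈ range N', X.ρ (γ ^ j) (a' j) - Z (X.ρ (γ ^ j) (a j)) =
      X.ρ φ (X.ρ (γ ^ j) (w j)) - X.ρ (γ ^ j) (w j) := by
    intro j hjm
    have h := congrArg (X.ρ (γ ^ j)) (hw j hjm)
    rw [map_sub, ρ_apply_ρ_inv_apply, rho_apply_rho_conj_sub] at h
    exact h
  have hsum := sum_congr rfl hj
  rw [sum_sub_distrib, ← map_sum, hcor, hcor', map_add, sum_sub_distrib, ← map_sum, map_sub Z,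
    hZφ] at hsum
  refine ⟨∑ j ∈ range N', X.ρ (γ ^ j) (w j) - t' + Z t, ?_⟩
  rw [map_add, map_sub]
  linear_combination (norm := abel) hsum

end Values

/-! ### §2 The congruence at a `p`-level where `φ` generates the layer -/

section Level

variable {K : Type u} [Field K] [NumberField K] {ι : Type w} [Preorder ι] [OrderBot ι]
variable {A : Type v} [CommRing A] [TopologicalSpace A]
variable {M : Type u} [AddCommGroup M] [Module A M] [TopologicalSpace M] [IsTopologicalAddGroup M]
  [ContinuousSMul A M] [Module.Free A M] [Module.Finite A M]
variable {L : EulerSystemLevels K ι} {T : GaloisRep K A M} {p : ℕ} [Fact p.Prime] [Algebra ℤ_[p] A]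
variable {c : ∀ (i : ι) (r : L.Ideals), H1 T (L.level i r.1)}

/-- **The Kolyvagin congruence of an Euler system at a layer generated by Frobenius**
([PerrinRiou98] Prop. 2.2.5 (ii), proof (2.2.6)–(2.2.8); Rubin, LNM 1716 Prop. 8.6).  See the module
docstring for the data.  For the Euler system `c` (`IsEulerSystem L T p c`: BOTH `cores_p`, at the
indices `rq` and `r` for the layers `i₀ ≤ i₂`, AND `cores_cons` at the layer `i₂` are used), every
representative `x₀'` of `c_{i₀,rq}` and `x₀` of `c_{i₀,r}` satisfy
`∃ w, x₀'(φ) − Z x₀(φ) = ρ(φ) w − w`.  All arithmetic of the Kolyvagin prime is displayed: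
`hcovφ'/hinjφ'/hcovφ/hinjφ` (the powers of `φ` are a transversal of both layers — `q` inert),
`hinjM` (`ρ(φ)^M − 1` injective), `hroom` (`(ρ(φ)−1)²T ⊆ pT`), `hM : M = p^n`, `hN : N_q = p^{r₁} d`
with `r₁ ≤ n` and `d` invertible, `hZ` (`P_q(Fr⁻¹) = N_q • Z`), `hurI'/hurI` (vanishing of
`T`-valued cocycles on the inertia-type subgroup `I` normalised by `D ∋ Fr, φ`).
[cite: PerrinRiou1998AIF, Prop. 2.2.5 (ii)] [cite: Rubin2000, Cor. 4.8.1] -/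
theorem exists_sub_eq_sub_one_apply_of_eulerSystem (hc : IsEulerSystem L T p c)
    (hp2 : p ≠ 2) {i₀ i₂ : ι} (hi : i₀ ≤ i₂) (r : L.Ideals)
    (q : HeightOneSpectrum (𝓞 K)) (hq : q ∈ L.primes) (hqr : q ∉ r.1)
    (hram : ¬ SubgroupIsUnramifiedAt K (L.level i₂ (r.cons q hq).1) q)
    (Fr : absoluteGaloisGroup K) (hFr : IsArithFrobAtPlace K q Fr)
    -- the tame transversal at the layer `i₂`
    (σ : absoluteGaloisGroup K) (Nq : ℕ) (hσ : σ ∈ L.level i₂ r.1)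
    (hcovσ : ∀ g ∈ L.level i₂ r.1, ∃ j < Nq, (σ ^ j)⁻¹ * g ∈ L.level i₂ (r.cons q hq).1)
    (hinjσ : ∀ j₁ < Nq, ∀ j₂ < Nq, (σ ^ j₁)⁻¹ * σ ^ j₂ ∈ L.level i₂ (r.cons q hq).1 → j₁ = j₂)
    (hσT : ∀ t : M, T.toTopRep.ρ σ t = t)
    -- the element `φ` generating both layers `i₀ → i₂`
    (φ : absoluteGaloisGroup K) (hφ₀ : φ ∈ L.level i₀ (r.cons q hq).1) (Mp n : ℕ) (hM : Mp = p ^ n)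
    (hφM : φ ^ Mp ∈ L.level i₂ (r.cons q hq).1)
    (hcovφ' : ∀ g ∈ L.level i₀ (r.cons q hq).1, ∃ j < Mp, (φ ^ j)⁻¹ * g ∈ L.level i₂ (r.cons q hq).1)
    (hinjφ' : ∀ j₁ < Mp, ∀ j₂ < Mp, (φ ^ j₁)⁻¹ * φ ^ j₂ ∈ L.level i₂ (r.cons q hq).1 → j₁ = j₂)
    (hcovφ : ∀ g ∈ L.level i₀ r.1, ∃ j < Mp, (φ ^ j)⁻¹ * g ∈ L.level i₂ r.1)
    (hinjφ : ∀ j₁ < Mp, ∀ j₂ < Mp, (φ ^ j₁)⁻¹ * φ ^ j₂ ∈ L.level i₂ r.1 → j₁ = j₂)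
    (hinjM : Function.Injective fun t : M => T.toTopRep.ρ (φ ^ Mp) t - t)
    (hroom : ∀ t : M, ∃ s : M, (T φ - 1) ((T φ - 1) t) = p • s)
    (htors : ∀ t : M, p • t = 0 → t = 0)
    {r₁ d : ℕ} (hN : Nq = p ^ r₁ * d) (hr₁n : r₁ ≤ n) (d' : A) (hd : ∀ t : M, d • d' • t = t)
    (Z : M →ₗ[A] M) (hcomm : Commute (T φ) Z)
    (hZ : ∀ t : M, ∑ k ∈ range ((rubinEulerFactor T.toRepresentation
        (cyclotomicCharacterToUnits K p A) Fr).natDegree + 1),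
      (rubinEulerFactor T.toRepresentation (cyclotomicCharacterToUnits K p A) Fr).coeff k •
        T.toTopRep.ρ (Fr⁻¹ ^ k) t = Nq • Z t)
    -- decomposition data at the prime: `I` normalised by `D ∋ Fr, φ`, `σ ∈ I`, `[φ, Fr] ∈ I`
    (I D : Subgroup (absoluteGaloisGroup K)) (hID : ∀ g ∈ D, ∀ τ ∈ I, g⁻¹ * τ * g ∈ I)
    (hσI : σ ∈ I) (hFrD : Fr ∈ D) (hφD : φ ∈ D) (hφFr : φ⁻¹ * Fr⁻¹ * φ * Fr ∈ I)
    (hurI' : ∀ (x : contOneCocycles (subgroupRep T.toTopRep (L.level i₂ (r.cons q hq).1)))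
      (τ : absoluteGaloisGroup K) (hτI : τ ∈ I) (hτ : τ ∈ L.level i₂ (r.cons q hq).1), x.1 ⟨τ, hτ⟩ = 0)
    (hurI : ∀ (x : contOneCocycles (subgroupRep T.toTopRep (L.level i₂ r.1)))
      (τ : absoluteGaloisGroup K) (hτI : τ ∈ I) (hτ : τ ∈ L.level i₂ r.1), x.1 ⟨τ, hτ⟩ = 0)
    -- representatives at the layer `i₀`
    (x₀' : contOneCocycles (subgroupRep T.toTopRep (L.level i₀ (r.cons q hq).1)))
    (hx₀' : oneCocycleClass _ x₀' = c i₀ (r.cons q hq))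
    (x₀ : contOneCocycles (subgroupRep T.toTopRep (L.level i₀ r.1)))
    (hx₀ : oneCocycleClass _ x₀ = c i₀ r) :
    ∃ w : M, x₀'.1 ⟨φ, hφ₀⟩ - Z (x₀.1 ⟨φ, L.level_insert_le i₀ r.1 q hφ₀⟩) = T φ w - w := by
  classical
  -- the four levels: `V₀' = level i₀ (rq) ≥ V₁' = level i₂ (rq)`, `V₀ = level i₀ r ≥ V₁ = level i₂ r`
  have h10' : L.level i₂ (r.cons q hq).1 ≤ L.level i₀ (r.cons q hq).1 := L.level_mono_left hi _
  have h10 : L.level i₂ r.1 ≤ L.level i₀ r.1 := L.level_mono_left hi _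
  have hle₁ : L.level i₂ (r.cons q hq).1 ≤ L.level i₂ r.1 := L.level_insert_le i₂ r.1 q
  have hle₀ : L.level i₀ (r.cons q hq).1 ≤ L.level i₀ r.1 := L.level_insert_le i₀ r.1 q
  have hφ₀r : φ ∈ L.level i₀ r.1 := hle₀ hφ₀
  have hφMr : φ ^ Mp ∈ L.level i₂ r.1 := hle₁ hφM
  -- representatives at the layer `i₂`
  obtain ⟨x₁', hx₁'⟩ := oneCocycleClass_surjective _ (c i₂ (r.cons q hq))
  obtain ⟨x₁, hx₁⟩ := oneCocycleClass_surjective _ (c i₂ r)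
  letI : Fintype (L.level i₀ (r.cons q hq).1 ⧸
      (L.level i₂ (r.cons q hq).1).subgroupOf (L.level i₀ (r.cons q hq).1)) := Fintype.ofFinite _
  letI : Fintype (L.level i₀ r.1 ⧸ (L.level i₂ r.1).subgroupOf (L.level i₀ r.1)) :=
    Fintype.ofFinite _
  letI : Fintype (L.level i₂ r.1 ⧸ (L.level i₂ (r.cons q hq).1).subgroupOf (L.level i₂ r.1)) :=
    Fintype.ofFinite _
  -- (2.2.6)–(2.2.7) at `rq`: `x₁'(φ^M) = x₀'(φ) + (φ − 1) e'`, from `cores_p`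
  have hCor' : coresLe T.toTopRep h10' (L.isOpen_level i₂ _) (oneCocycleClass _ x₁') =
      oneCocycleClass _ x₀' := by
    rw [hx₁', hx₀']; exact hc.cores_p hi (r.cons q hq)
  obtain ⟨e', he'⟩ := exists_forall_sum_rho_pow_apply_eq_of_coresLe_eq T.toTopRep h10'
    (L.isOpen_level i₂ _) hφ₀ hcovφ' hinjφ' x₁' x₀' hCor'
  have htr' : x₁'.1 ⟨φ ^ Mp, hφM⟩ = x₀'.1 ⟨φ, hφ₀⟩ + (T.toTopRep.ρ φ e' - e') :=
    eq_add_rho_sub_of_sum_conj_eq T.toTopRep x₁' x₀' hφ₀ hφM e' (he' ⟨φ ^ Mp, hφM⟩) hinjM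
  -- (2.2.6)–(2.2.7) at `r`: `x₁(φ^M) = x₀(φ) + (φ − 1) e`
  have hCor : coresLe T.toTopRep h10 (L.isOpen_level i₂ _) (oneCocycleClass _ x₁) =
      oneCocycleClass _ x₀ := by
    rw [hx₁, hx₀]; exact hc.cores_p hi r
  obtain ⟨e, he⟩ := exists_forall_sum_rho_pow_apply_eq_of_coresLe_eq T.toTopRep h10
    (L.isOpen_level i₂ _) hφ₀r hcovφ hinjφ x₁ x₀ hCor
  have htr : x₁.1 ⟨φ ^ Mp, hφMr⟩ = x₀.1 ⟨φ, hφ₀r⟩ + (T.toTopRep.ρ φ e - e) :=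
    eq_add_rho_sub_of_sum_conj_eq T.toTopRep x₁ x₀ hφ₀r hφMr e (he ⟨φ ^ Mp, hφMr⟩) hinjM
  -- (2.2.8): the tame relation at the layer `i₂`, from `cores_cons`, evaluated at `φ^M`
  have hCons : coresLe T.toTopRep hle₁ (L.isOpen_level i₂ _) (oneCocycleClass _ x₁') =
      aeval (conjMap T.toTopRep (L.level i₂ r.1) Fr⁻¹ 1).hom.toLinearMap
        (rubinEulerFactor T.toRepresentation (cyclotomicCharacterToUnits K p A) Fr)
        (oneCocycleClass _ x₁) := by
    rw [hx₁', hx₁]; exact hc.cores_cons i₂ r q hq hqr hram Fr hFr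
  obtain ⟨b, hb⟩ := exists_forall_sum_rho_pow_apply_eq_of_coresLe_eq_aeval T.toTopRep hle₁
    (L.isOpen_level i₂ _) hσ hcovσ hinjσ Fr⁻¹ _ x₁' x₁ hCons
  have hbM := hb ⟨φ ^ Mp, hφM⟩
  -- left side: `N_q • x₁'(φ^M)` (σ acts trivially on `T`, `x₁'` kills `φ^{-M}σ^{-i}φ^Mσ^i ∈ I`)
  have hφMD : φ ^ Mp ∈ D := D.pow_mem hφD Mp
  have hkill' : ∀ i : ℕ, x₁'.1 (⟨φ ^ Mp, hφM⟩⁻¹ *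
      subgroupConj (L.level i₂ (r.cons q hq).1) (σ ^ i) ⟨φ ^ Mp, hφM⟩) = 0 :=
    fun i => hurI' x₁' _ (inv_mul_conj_pow_mem I D hID hσI hφMD i) _
  rw [Derivative.sum_rho_pow_apply_subgroupConj_eq_nsmul T.toTopRep (L.level i₂ (r.cons q hq).1) σ hσT Nq x₁'
    ⟨φ ^ Mp, hφM⟩ hkill'] at hbM
  -- right side: `x₁(Fr^k φ^M Fr^{-k}) = x₁(φ^M)` (`x₁` kills `φ^{-M}Fr^kφ^MFr^{-k} ∈ I`)
  have hincl : subgroupInclusion hle₁ ⟨φ ^ Mp, hφM⟩ = ⟨φ ^ Mp, hφMr⟩ := rfl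
  -- `[φ, Fr⁻¹] ∈ I` from `[φ, Fr] ∈ I` (conjugate the inverse by `Fr`)
  have hφFr' : φ⁻¹ * (Fr⁻¹)⁻¹ * φ * Fr⁻¹ ∈ I := by
    have h1 : φ⁻¹ * (Fr⁻¹)⁻¹ * φ * Fr⁻¹ = (Fr⁻¹)⁻¹ * (φ⁻¹ * Fr⁻¹ * φ * Fr)⁻¹ * Fr⁻¹ := by group
    rw [h1]
    exact hID Fr⁻¹ (D.inv_mem hFrD) _ (I.inv_mem hφFr)
  have hkill : ∀ k : ℕ, x₁.1 (⟨φ ^ Mp, hφMr⟩⁻¹ *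
      subgroupConj (L.level i₂ r.1) (Fr⁻¹ ^ k) ⟨φ ^ Mp, hφMr⟩) = 0 := by
    intro k
    refine hurI x₁ _ ?_ _
    have h1 : (φ ^ Mp)⁻¹ * ((Fr⁻¹ ^ k)⁻¹ * φ ^ Mp * Fr⁻¹ ^ k) =
        (φ ^ Mp)⁻¹ * (Fr⁻¹ ^ k)⁻¹ * φ ^ Mp * Fr⁻¹ ^ k := by group
    change (φ ^ Mp)⁻¹ * ((Fr⁻¹ ^ k)⁻¹ * φ ^ Mp * Fr⁻¹ ^ k) ∈ I
    rw [h1]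
    exact commutator_pow_pow_mem I D hID hφD (D.inv_mem hFrD) hφFr' Mp k
  have hR : ∀ k : ℕ, x₁.1 (subgroupConj (L.level i₂ r.1) (Fr⁻¹ ^ k) ⟨φ ^ Mp, hφMr⟩) =
      x₁.1 ⟨φ ^ Mp, hφMr⟩ := by
    intro k
    have hmul : subgroupConj (L.level i₂ r.1) (Fr⁻¹ ^ k) ⟨φ ^ Mp, hφMr⟩ = ⟨φ ^ Mp, hφMr⟩ *
        (⟨φ ^ Mp, hφMr⟩⁻¹ * subgroupConj (L.level i₂ r.1) (Fr⁻¹ ^ k) ⟨φ ^ Mp, hφMr⟩) := by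
      rw [mul_inv_cancel_left]
    rw [hmul, subgroup_cocycle_mul, hkill k, map_zero, add_zero]
  rw [hincl, sum_congr rfl fun k _ => by rw [hR k], hZ] at hbM
  -- `hbM : N_q • y₁' = N_q • Z y₁ + (φ^M b − b)`; the room `(Φ^M − 1) b = (Φ − 1)(p^n s)` (C0a)
  obtain ⟨s, hs⟩ := exists_pow_prime_pow_sub_one_apply_eq' p (Fact.out) hp2 n (T φ) hroom b
  -- C0b: divide by `q − 1`
  have hΦM : ∀ t : M, (T φ ^ Mp) t = T.toTopRep.ρ (φ ^ Mp) t := fun t => by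
    rw [← map_pow]; rfl
  refine exists_sub_eq_sub_one_apply_of_ascent p htors (T φ) Z hcomm hN hr₁n d' hd Mp
    (x₀.1 ⟨φ, hφ₀r⟩) (x₀'.1 ⟨φ, hφ₀⟩) (x₁.1 ⟨φ ^ Mp, hφMr⟩) (x₁'.1 ⟨φ ^ Mp, hφM⟩) e e' b s ?_ ?_ ?_ ?_
  · -- `htame`
    rw [LinearMap.sub_apply, Module.End.one_apply, hΦM, sub_eq_iff_eq_add]
    simpa only [add_comm] using hbM
  · rw [htr']; rfl
  · rw [htr]; rfl
  · rw [hM, hs]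

/-- **Descent of the Kolyvagin congruence to the bottom layer** ([PerrinRiou98] Prop. 2.2.5
(ii), last sentence: "en appliquant la corestriction de `ℚ(μ_{mℓp^r})` à `ℚ(μ_{mℓp})`"; here down
to the bottom layer `⊥` where Kolyvagin's derivative classes live).  Let `γ ∈ Gal(K̄/K(rq))` have
powers `γ^j` (`j < N'`) forming a transversal of BOTH `Gal(F_{i₀}(rq)/K(rq))` and
`Gal(F_{i₀}(r)/K(r))` (for `ℚ(μ_{p^∞})`, `p` odd: a generator of `(ℤ/p^{i₀})ˣ` — n1011-p15
`Rat.exists_generator_level_bot`), `φ ∈ Gal(K̄/F_{i₀}(rq))`, `Z` commuting with `ρ(φ)`, and SUPPOSE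
the layer-`i₀` congruence at every conjugate datum `(γ^{-j}φγ^j, ρ(γ^j)⁻¹ Z ρ(γ^j))`, `j < N'`,
for all representatives (`hcong`; supplied by `exists_sub_eq_sub_one_apply_of_eulerSystem` at the
conjugate primes `γ^{-j}𝔔`).  Then, by `IsEulerSystem.cores_p` (`⊥ ≤ i₀`, at `rq` and at `r`; G1
`exists_forall_sum_rho_pow_apply_eq_of_coresLe_eq`) and C0c `exists_sub_eq_sub_one_apply_of_descent`,
every representative `x₀'` of `c_{⊥,rq}` and `x₀` of `c_{⊥,r}` satisfy
`∃ w, x₀'(φ) − Z x₀(φ) = ρ(φ) w − w`. [cite: PerrinRiou1998AIF, Prop. 2.2.5 (ii)] -/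
theorem exists_sub_eq_sub_one_apply_of_eulerSystem_bot (hc : IsEulerSystem L T p c) (i₀ : ι)
    (r : L.Ideals) (q : HeightOneSpectrum (𝓞 K)) (hq : q ∈ L.primes)
    (γ : absoluteGaloisGroup K) (N' : ℕ) (hγ : γ ∈ L.level ⊥ (r.cons q hq).1)
    (hcovγ' : ∀ g ∈ L.level ⊥ (r.cons q hq).1, ∃ j < N', (γ ^ j)⁻¹ * g ∈ L.level i₀ (r.cons q hq).1)
    (hinjγ' : ∀ j₁ < N', ∀ j₂ < N', (γ ^ j₁)⁻¹ * γ ^ j₂ ∈ L.level i₀ (r.cons q hq).1 → j₁ = j₂)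
    (hcovγ : ∀ g ∈ L.level ⊥ r.1, ∃ j < N', (γ ^ j)⁻¹ * g ∈ L.level i₀ r.1)
    (hinjγ : ∀ j₁ < N', ∀ j₂ < N', (γ ^ j₁)⁻¹ * γ ^ j₂ ∈ L.level i₀ r.1 → j₁ = j₂)
    (φ : absoluteGaloisGroup K) (hφ : φ ∈ L.level i₀ (r.cons q hq).1)
    (Z : M →ₗ[A] M) (hZφ : ∀ t : M, Z (T.toTopRep.ρ φ t) = T.toTopRep.ρ φ (Z t))
    (hcong : ∀ j < N', ∀ (h₁ : (γ ^ j)⁻¹ * φ * γ ^ j ∈ L.level i₀ (r.cons q hq).1)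
      (h₂ : (γ ^ j)⁻¹ * φ * γ ^ j ∈ L.level i₀ r.1)
      (xr' : contOneCocycles (subgroupRep T.toTopRep (L.level i₀ (r.cons q hq).1)))
      (xr : contOneCocycles (subgroupRep T.toTopRep (L.level i₀ r.1))),
      oneCocycleClass _ xr' = c i₀ (r.cons q hq) → oneCocycleClass _ xr = c i₀ r →
        ∃ w : M, xr'.1 ⟨(γ ^ j)⁻¹ * φ * γ ^ j, h₁⟩ -
            T.toTopRep.ρ (γ ^ j)⁻¹ (Z (T.toTopRep.ρ (γ ^ j) (xr.1 ⟨(γ ^ j)⁻¹ * φ * γ ^ j, h₂⟩))) =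
          T.toTopRep.ρ ((γ ^ j)⁻¹ * φ * γ ^ j) w - w)
    (x₀' : contOneCocycles (subgroupRep T.toTopRep (L.level ⊥ (r.cons q hq).1)))
    (hx₀' : oneCocycleClass _ x₀' = c ⊥ (r.cons q hq))
    (x₀ : contOneCocycles (subgroupRep T.toTopRep (L.level ⊥ r.1)))
    (hx₀ : oneCocycleClass _ x₀ = c ⊥ r) :
    ∃ w : M, x₀'.1 ⟨φ, L.level_mono_left bot_le _ hφ⟩ -
        Z (x₀.1 ⟨φ, L.level_mono_left bot_le _ (L.level_insert_le i₀ r.1 q hφ)⟩) =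
      T.toTopRep.ρ φ w - w := by
  classical
  have hr0' : L.level i₀ (r.cons q hq).1 ≤ L.level ⊥ (r.cons q hq).1 := L.level_mono_left bot_le _
  have hr0 : L.level i₀ r.1 ≤ L.level ⊥ r.1 := L.level_mono_left bot_le _
  have hleᵢ : L.level i₀ (r.cons q hq).1 ≤ L.level i₀ r.1 := L.level_insert_le i₀ r.1 q
  have hle₀ : L.level ⊥ (r.cons q hq).1 ≤ L.level ⊥ r.1 := L.level_insert_le ⊥ r.1 q
  have hφr : φ ∈ L.level i₀ r.1 := hleᵢ hφ
  have hφ0' : φ ∈ L.level ⊥ (r.cons q hq).1 := hr0' hφ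
  have hγr : γ ∈ L.level ⊥ r.1 := hle₀ hγ
  -- representatives at the layer `i₀`
  obtain ⟨xr', hxr'⟩ := oneCocycleClass_surjective _ (c i₀ (r.cons q hq))
  obtain ⟨xr, hxr⟩ := oneCocycleClass_surjective _ (c i₀ r)
  letI : Fintype (L.level ⊥ (r.cons q hq).1 ⧸
      (L.level i₀ (r.cons q hq).1).subgroupOf (L.level ⊥ (r.cons q hq).1)) := Fintype.ofFinite _
  letI : Fintype (L.level ⊥ r.1 ⧸ (L.level i₀ r.1).subgroupOf (L.level ⊥ r.1)) := Fintype.ofFinite _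
  -- `cores_p` at `rq` and at `r`, at cocycle level (G1)
  have hCor' : coresLe T.toTopRep hr0' (L.isOpen_level i₀ _) (oneCocycleClass _ xr') =
      oneCocycleClass _ x₀' := by
    rw [hxr', hx₀']; exact hc.cores_p bot_le (r.cons q hq)
  obtain ⟨t', ht'⟩ := exists_forall_sum_rho_pow_apply_eq_of_coresLe_eq T.toTopRep hr0'
    (L.isOpen_level i₀ _) hγ hcovγ' hinjγ' xr' x₀' hCor'
  have hCor : coresLe T.toTopRep hr0 (L.isOpen_level i₀ _) (oneCocycleClass _ xr) =
      oneCocycleClass _ x₀ := by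
    rw [hxr, hx₀]; exact hc.cores_p bot_le r
  obtain ⟨t, ht⟩ := exists_forall_sum_rho_pow_apply_eq_of_coresLe_eq T.toTopRep hr0
    (L.isOpen_level i₀ _) hγr hcovγ hinjγ xr x₀ hCor
  -- the conjugates `φ_j = γ^{-j} φ γ^j` as elements of the two layer-`i₀` groups
  have h₁ : ∀ j : ℕ, (γ ^ j)⁻¹ * φ * γ ^ j ∈ L.level i₀ (r.cons q hq).1 := fun j =>
    (subgroupConj (L.level i₀ (r.cons q hq).1) (γ ^ j) ⟨φ, hφ⟩).2
  have h₂ : ∀ j : ℕ, (γ ^ j)⁻¹ * φ * γ ^ j ∈ L.level i₀ r.1 := fun j => hleᵢ (h₁ j)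
  have hconj' : ∀ j : ℕ, subgroupConj (L.level i₀ (r.cons q hq).1) (γ ^ j) ⟨φ, hφ⟩ =
      ⟨(γ ^ j)⁻¹ * φ * γ ^ j, h₁ j⟩ := fun j => Subtype.ext rfl
  have hconj : ∀ j : ℕ, subgroupConj (L.level i₀ r.1) (γ ^ j) ⟨φ, hφr⟩ =
      ⟨(γ ^ j)⁻¹ * φ * γ ^ j, h₂ j⟩ := fun j => Subtype.ext rfl
  have hincl' : subgroupInclusion hr0' ⟨φ, hφ⟩ = ⟨φ, hφ0'⟩ := Subtype.ext rfl
  have hincl : subgroupInclusion hr0 ⟨φ, hφr⟩ =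
      ⟨φ, L.level_mono_left bot_le _ (L.level_insert_le i₀ r.1 q hφ)⟩ := Subtype.ext rfl
  -- C0c on values
  refine exists_sub_eq_sub_one_apply_of_descent_values T.toTopRep Z φ γ N' hZφ
    (fun j => xr.1 (subgroupConj (L.level i₀ r.1) (γ ^ j) ⟨φ, hφr⟩))
    (fun j => xr'.1 (subgroupConj (L.level i₀ (r.cons q hq).1) (γ ^ j) ⟨φ, hφ⟩)) _ _ t t'
    (by rw [← hincl]; exact ht ⟨φ, hφr⟩) (by rw [← hincl']; exact ht' ⟨φ, hφ⟩) fun j hj => ?_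
  rw [hconj' j, hconj j]
  exact hcong j (mem_range.mp hj) (h₁ j) (h₂ j) xr' xr hxr' hxr

end Level

end Congruence

end Summit.BirchSwinnertonDyer.Rank1Residual.GaloisImage

end
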